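import Summits.KontsevichZagierPeriods.KontsevichZagierPeriods.Theorems.RootDecompZetaThreeFrontierRungFourPreludeP10

/-! # `RootDecompZetaThreeFrontierRungFourPreludeP11` — part 11/14 of the mechanical ≤400-line split of `pre_src.lean` (sha256 ba362a5194d75c20…)
Source: decomp-kz lens-1 g12/g13 rung-4 prelude = Prelude_v3.lean @ba362a51 (Basis22_v1 sections RotFour/Shuffle/ProdFour/GenFb/WordMoves/RungFour/Basis22 + FacetGeneric_v2 §1–§23; critic CLEARED g6 row 330 / g6-20 l.1368); --supports stmt-KontsevichZagierPeriods-27141.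
Split by census-1 g10 `gen/splitlean.py`: scopes re-opened with their `open`/`variable`/`set_option` context; mathematics and declaration order unchanged. -/

set_option linter.dupNamespace false
open MeasureTheory Set
open Literature.NumberTheory.Transcendental
set_option linter.dupNamespace false
namespace Summit.KontsevichZagierPeriods.KontsevichZagierPeriods.Cruxes.GZNormalFormWThree.GZLadder.RungFour
open Summit.KontsevichZagierPeriods.KontsevichZagierPeriods.Cruxes.GZNormalFormWThree.GZLadder.FacetFour
  (not_integrableOn_of_residue)
section RunChart
variable {M : ℕ}

/-- Auxiliary step `mapR_apply_int`: map R apply int. [bookkeeping] -/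
theorem mapR_apply_int {a b i : Fin (M + 1)} (h1 : a < i) (h2 : i < b) (p : Fin (M + 1) → ℝ) :
    mapR a b p i = p a - p b * p i := by
  simp [mapR, psiR, sigR, h1, h2, h2.le]

/-- Auxiliary step `mapR_apply_a`: map R apply a. [bookkeeping] -/
theorem mapR_apply_a (a b : Fin (M + 1)) (p : Fin (M + 1) → ℝ) : mapR a b p a = p a :=
  mapR_apply_out (Or.inl le_rfl) p

/-- the next point below the run: `p_{b+1}`, or `0` if `b` is the last index -/
def lowR (b : Fin (M + 1)) (p : Fin (M + 1) → ℝ) : ℝ := if h : (b : ℕ) < M then p ⟨(b : ℕ) + 1, by omega⟩ else 0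

/-- the chart domain -/
def domR (a b : Fin (M + 1)) : Set (Fin (M + 1) → ℝ) :=
  {p | (∀ i, i ≤ a → 0 < p i ∧ p i < 1) ∧ (∀ i i', i < i' → i' ≤ a → p i' < p i) ∧ 0 < p b ∧
    (∀ i, a < i → i < b → 0 < p i ∧ p i < 1) ∧ (∀ i i', a < i → i < i' → i' < b → p i < p i') ∧
    (∀ i, b < i → 0 < p i) ∧ (∀ i i', b < i → i < i' → p i' < p i) ∧ lowR b p < p a - p b}

/-- Auxiliary step `lowR_nonneg`: low R nonneg. [bookkeeping] -/
theorem lowR_nonneg {a b : Fin (M + 1)} {p : Fin (M + 1) → ℝ} (hp : p ∈ domR a b) : 0 ≤ lowR b p := by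
  unfold lowR; split_ifs with h
  · exact (hp.2.2.2.2.2.1 _ (Fin.lt_def.2 (by simp))).le
  · exact le_rfl

/-- Auxiliary step `le_lowR`: le low R. [bookkeeping] -/
theorem le_lowR {a b : Fin (M + 1)} {p : Fin (M + 1) → ℝ} (hp : p ∈ domR a b) (i : Fin (M + 1)) (hi : b < i) :
    p i ≤ lowR b p := by
  have hi' : (b : ℕ) < i := hi
  unfold lowR
  rw [dif_pos (by omega)]
  rcases (show (b : ℕ) + 1 = i ∨ (b : ℕ) + 1 < i by omega) with h | h
  · have : (⟨(b : ℕ) + 1, by omega⟩ : Fin (M + 1)) = i := Fin.ext (by simpa using h)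
    rw [this]
  · exact (hp.2.2.2.2.2.2.1 ⟨(b : ℕ) + 1, by omega⟩ i (Fin.lt_def.2 (by simp)) (Fin.lt_def.2 (by simpa using h))).le

/-- Auxiliary step `mapR_mem`: map R mem. [bookkeeping] -/
theorem mapR_mem {a b : Fin (M + 1)} (hab : a < b) {p : Fin (M + 1) → ℝ} (hp : p ∈ domR a b) :
    mapR a b p ∈ KZ.openOrderedSimplex (M + 1) := by
  have hlow0 := lowR_nonneg hp
  have hlow := le_lowR hp
  obtain ⟨hh, hhd, hε, hs, hsi, htp, htd, hl⟩ := hp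
  have hpa := hh a le_rfl
  -- basic comparisons
  have hbot : lowR b p < mapR a b p b := by rw [mapR_apply_bot hab]; exact hl
  have hint_gt : ∀ i, a < i → i < b → mapR a b p b < mapR a b p i := fun i h1 h2 => by
    rw [mapR_apply_bot hab, mapR_apply_int h1 h2]
    have := (hs i h1 h2).2
    nlinarith
  have hrun_lt : ∀ i, a < i → i ≤ b → mapR a b p i < p a := fun i h1 h2 => by
    rcases h2.lt_or_eq with h2 | h2
    · rw [mapR_apply_int h1 h2]; nlinarith [(hs i h1 h2).1]
    · rw [h2, mapR_apply_bot hab]; linarith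
  have hhead_ge : ∀ i, i ≤ a → p a ≤ mapR a b p i := fun i h => by
    rw [mapR_apply_out (Or.inl h)]
    rcases h.lt_or_eq with h | h
    · exact (hhd i a h le_rfl).le
    · rw [h]
  have htail_le : ∀ i, b < i → mapR a b p i ≤ lowR b p := fun i h => by
    rw [mapR_apply_out (Or.inr h)]; exact hlow i h
  refine ⟨fun i => ?_, fun i => ?_, fun i i' hlt => ?_⟩
  · -- positivity
    by_cases h1 : i ≤ a
    · rw [mapR_apply_out (Or.inl h1)]; exact (hh i h1).1
    by_cases h2 : b < i
    · rw [mapR_apply_out (Or.inr h2)]; exact htp i h2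
    rcases (not_lt.1 h2).lt_or_eq with h3 | h3
    · linarith [hint_gt i (not_le.1 h1) h3]
    · rw [h3]; linarith
  · -- below 1
    by_cases h1 : i ≤ a
    · rw [mapR_apply_out (Or.inl h1)]; exact (hh i h1).2
    by_cases h2 : b < i
    · linarith [htail_le i h2, hrun_lt b hab le_rfl, hpa.2]
    · linarith [hrun_lt i (not_le.1 h1) (not_lt.1 h2), hpa.2]
  · -- strictly decreasing
    show mapR a b p i' < mapR a b p i
    by_cases h1' : i' ≤ a
    · rw [mapR_apply_out (Or.inl h1'), mapR_apply_out (Or.inl (hlt.le.trans h1'))]; exact hhd i i' hlt h1'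
    have ha' : a < i' := not_le.1 h1'
    by_cases h1 : i ≤ a
    · -- i in the head, i' after a
      refine lt_of_lt_of_le ?_ (hhead_ge i h1)
      by_cases h2' : b < i'
      · linarith [htail_le i' h2', hrun_lt b hab le_rfl]
      · exact hrun_lt i' ha' (not_lt.1 h2')
    have ha : a < i := not_le.1 h1
    by_cases h2 : b < i
    · rw [mapR_apply_out (Or.inr h2), mapR_apply_out (Or.inr (h2.trans hlt))]; exact htd i i' h2 hlt
    rcases (not_lt.1 h2).lt_or_eq with hib | hib
    · -- i interior
      by_cases h2' : b < i'
      · linarith [htail_le i' h2', hint_gt i ha hib]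
      rcases (not_lt.1 h2').lt_or_eq with hib' | hib'
      · rw [mapR_apply_int ha hib, mapR_apply_int ha' hib']
        have := hsi i i' ha hlt hib'
        nlinarith
      · rw [hib']; exact hint_gt i ha hib
    · -- i = b, i' in the tail
      rw [hib]
      have h2' : b < i' := hib ▸ hlt
      linarith [htail_le i' h2']

/-- inverse chart -/
noncomputable def invR (a b : Fin (M + 1)) (t : Fin (M + 1) → ℝ) : Fin (M + 1) → ℝ :=
  fun i => if i ≤ a ∨ b < i then t i else if i = b then t a - t b else (t a - t i) / (t a - t b)

/-- Auxiliary step `invR_apply_out`: inv R apply out. [bookkeeping] -/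
theorem invR_apply_out {a b i : Fin (M + 1)} (h : i ≤ a ∨ b < i) (t : Fin (M + 1) → ℝ) : invR a b t i = t i := by
  simp [invR, h]

/-- Auxiliary step `invR_apply_bot`: inv R apply bot. [bookkeeping] -/
theorem invR_apply_bot {a b : Fin (M + 1)} (hab : a < b) (t : Fin (M + 1) → ℝ) : invR a b t b = t a - t b := by
  have : ¬ (b ≤ a ∨ b < b) := by rintro (h | h); exact absurd hab (not_lt.2 h); exact lt_irrefl _ h
  simp only [invR]
  rw [if_neg this]
  simp

/-- Auxiliary step `invR_apply_int`: inv R apply int. [bookkeeping] -/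
theorem invR_apply_int {a b i : Fin (M + 1)} (h1 : a < i) (h2 : i < b) (t : Fin (M + 1) → ℝ) :
    invR a b t i = (t a - t i) / (t a - t b) := by
  have : ¬ (i ≤ a ∨ b < i) := by rintro (h | h); exact absurd h1 (not_lt.2 h); exact absurd h2 (not_lt.2 h.le)
  simp [invR, this, h2.ne]

/-- Auxiliary step `invR_mem`: inv R mem. [bookkeeping] -/
theorem invR_mem {a b : Fin (M + 1)} (hab : a < b) {t : Fin (M + 1) → ℝ} (ht : t ∈ KZ.openOrderedSimplex (M + 1)) :
    invR a b t ∈ domR a b := by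
  obtain ⟨h0, h1, han⟩ := ht
  have hab' : 0 < t a - t b := sub_pos.2 (han hab)
  have hia : invR a b t a = t a := invR_apply_out (Or.inl le_rfl) t
  refine ⟨fun i hi => ?_, fun i i' hlt hi' => ?_, ?_, fun i hi1 hi2 => ?_, fun i i' hi hlt hi' => ?_,
    fun i hi => ?_, fun i i' hi hlt => ?_, ?_⟩
  · rw [invR_apply_out (Or.inl hi)]; exact ⟨h0 i, h1 i⟩
  · rw [invR_apply_out (Or.inl hi'), invR_apply_out (Or.inl (hlt.le.trans hi'))]; exact han hlt
  · rw [invR_apply_bot hab]; exact hab'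
  · rw [invR_apply_int hi1 hi2]
    exact ⟨div_pos (sub_pos.2 (han hi1)) hab', by rw [div_lt_one hab']; linarith [han hi2]⟩
  · rw [invR_apply_int hi (hlt.trans hi'), invR_apply_int (hi.trans hlt) hi']
    exact div_lt_div_of_pos_right (by linarith [han hlt]) hab'
  · rw [invR_apply_out (Or.inr hi)]; exact h0 i
  · rw [invR_apply_out (Or.inr hi), invR_apply_out (Or.inr (hi.trans hlt))]; exact han hlt
  · rw [hia, invR_apply_bot hab]
    unfold lowR
    split_ifs with h
    · have hb1 : b < (⟨(b : ℕ) + 1, by omega⟩ : Fin (M + 1)) := Fin.lt_def.2 (by simp)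
      rw [invR_apply_out (Or.inr hb1)]
      linarith [han hb1]
    · linarith [h0 b]

/-- Auxiliary step `mapR_invR`: map R inv R. [bookkeeping] -/
theorem mapR_invR {a b : Fin (M + 1)} (hab : a < b) {t : Fin (M + 1) → ℝ} (ht : t ∈ KZ.openOrderedSimplex (M + 1)) :
    mapR a b (invR a b t) = t := by
  have hab' : t a - t b ≠ 0 := (sub_pos.2 (ht.2.2 hab)).ne'
  have hia : invR a b t a = t a := invR_apply_out (Or.inl le_rfl) t
  funext i
  by_cases h : i ≤ a ∨ b < i
  · rw [mapR_apply_out h, invR_apply_out h]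
  push Not at h
  rcases h.2.lt_or_eq with h2 | h2
  · rw [mapR_apply_int h.1 h2, hia, invR_apply_bot hab, invR_apply_int h.1 h2]
    field_simp; ring
  · rw [h2, mapR_apply_bot hab, hia, invR_apply_bot hab]; ring

/-- Auxiliary step `invR_mapR`: inv R map R. [bookkeeping] -/
theorem invR_mapR {a b : Fin (M + 1)} (hab : a < b) {p : Fin (M + 1) → ℝ} (hp : p ∈ domR a b) :
    invR a b (mapR a b p) = p := by
  have hb : p b ≠ 0 := hp.2.2.1.ne'
  funext i
  by_cases h : i ≤ a ∨ b < i
  · rw [invR_apply_out h, mapR_apply_out h]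
  push Not at h
  rcases h.2.lt_or_eq with h2 | h2
  · rw [invR_apply_int h.1 h2, mapR_apply_a, mapR_apply_bot hab, mapR_apply_int h.1 h2,
      show p a - (p a - p b * p i) = p b * p i by ring, show p a - (p a - p b) = p b by ring]
    field_simp
  · rw [h2, invR_apply_bot hab, mapR_apply_a, mapR_apply_bot hab]; ring

/-- Auxiliary step `image_mapR`: image map R. [bookkeeping] -/
theorem image_mapR {a b : Fin (M + 1)} (hab : a < b) : mapR a b '' domR a b = KZ.openOrderedSimplex (M + 1) := by
  ext t
  constructor
  · rintro ⟨p, hp, rfl⟩; exact mapR_mem hab hp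
  · intro ht; exact ⟨invR a b t, invR_mem hab ht, mapR_invR hab ht⟩

/-- Auxiliary step `injOn_mapR`: inj On map R. [bookkeeping] -/
theorem injOn_mapR {a b : Fin (M + 1)} (hab : a < b) : InjOn (mapR a b) (domR a b) :=
  fun p hp q hq h => by rw [← invR_mapR hab hp, ← invR_mapR hab hq, h]

/-- Auxiliary step `continuous_lowR`: continuous low R. [bookkeeping] -/
theorem continuous_lowR (b : Fin (M + 1)) : Continuous (lowR (M := M) b) := by
  unfold lowR; split_ifs <;> fun_prop

/-- helper: a set `{p | P → Q → f p < g p}` with `P, Q` independent of `p` is open for continuous `f, g` -/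
theorem isOpen_imp_imp_lt {X : Type*} [TopologicalSpace X] (P Q : Prop) {f g : X → ℝ} (hf : Continuous f)
    (hg : Continuous g) : IsOpen {x : X | P → Q → f x < g x} := by
  by_cases h : P ∧ Q
  · have : {x : X | P → Q → f x < g x} = {x | f x < g x} := by
      ext x; simp only [Set.mem_setOf_eq]; exact ⟨fun hx => hx h.1 h.2, fun hx _ _ => hx⟩
    rw [this]; exact isOpen_lt hf hg
  · have : {x : X | P → Q → f x < g x} = Set.univ := by
      ext x; simp only [Set.mem_setOf_eq, Set.mem_univ, iff_true]; exact fun h1 h2 => absurd ⟨h1, h2⟩ h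
    rw [this]; exact isOpen_univ

/-- Auxiliary step `isOpen_imp_lt`: is Open imp lt. [bookkeeping] -/
theorem isOpen_imp_lt {X : Type*} [TopologicalSpace X] (P : Prop) {f g : X → ℝ} (hf : Continuous f)
    (hg : Continuous g) : IsOpen {x : X | P → f x < g x} := by
  have := isOpen_imp_imp_lt P True hf hg
  have e : {x : X | P → True → f x < g x} = {x | P → f x < g x} := by
    ext x; simp only [Set.mem_setOf_eq]; exact ⟨fun h hp => h hp trivial, fun h hp _ => h hp⟩
  rwa [e] at this

/-- Auxiliary step `isOpen_imp3_lt`: is Open imp3 lt. [bookkeeping] -/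
theorem isOpen_imp3_lt {X : Type*} [TopologicalSpace X] (P Q R : Prop) {f g : X → ℝ} (hf : Continuous f)
    (hg : Continuous g) : IsOpen {x : X | P → Q → R → f x < g x} := by
  have := isOpen_imp_imp_lt P (Q ∧ R) hf hg
  have e : {x : X | P → Q ∧ R → f x < g x} = {x | P → Q → R → f x < g x} := by
    ext x; simp only [Set.mem_setOf_eq]; exact ⟨fun h hp hq hr => h hp ⟨hq, hr⟩, fun h hp hqr => h hp hqr.1 hqr.2⟩
  rwa [e] at this

/-- Auxiliary step `isOpen_domR`: is Open dom R. [bookkeeping] -/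
theorem isOpen_domR (a b : Fin (M + 1)) : IsOpen (domR (M := M) a b) := by
  have e : domR (M := M) a b =
      (⋂ i, {p : Fin (M + 1) → ℝ | i ≤ a → (0:ℝ) < p i} ∩ {p | i ≤ a → p i < 1}) ∩
      (⋂ i, ⋂ i', {p : Fin (M + 1) → ℝ | i < i' → i' ≤ a → p i' < p i}) ∩
      {p | (0:ℝ) < p b} ∩
      (⋂ i, {p : Fin (M + 1) → ℝ | a < i → i < b → (0:ℝ) < p i} ∩ {p | a < i → i < b → p i < 1}) ∩
      (⋂ i, ⋂ i', {p : Fin (M + 1) → ℝ | a < i → i < i' → i' < b → p i < p i'}) ∩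
      (⋂ i, {p : Fin (M + 1) → ℝ | b < i → (0:ℝ) < p i}) ∩
      (⋂ i, ⋂ i', {p : Fin (M + 1) → ℝ | b < i → i < i' → p i' < p i}) ∩
      {p | lowR b p < p a - p b} := by
    ext p
    simp only [domR, Set.mem_setOf_eq, Set.mem_inter_iff, Set.mem_iInter]
    constructor
    · rintro ⟨h1, h2, h3, h4, h5, h6, h7, h8⟩
      exact ⟨⟨⟨⟨⟨⟨⟨fun i => ⟨fun hi => (h1 i hi).1, fun hi => (h1 i hi).2⟩, h2⟩, h3⟩,
        fun i => ⟨fun hi hi' => (h4 i hi hi').1, fun hi hi' => (h4 i hi hi').2⟩⟩, h5⟩, h6⟩, h7⟩, h8⟩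
    · rintro ⟨⟨⟨⟨⟨⟨⟨h1, h2⟩, h3⟩, h4⟩, h5⟩, h6⟩, h7⟩, h8⟩
      exact ⟨fun i hi => ⟨(h1 i).1 hi, (h1 i).2 hi⟩, h2, h3, fun i hi hi' => ⟨(h4 i).1 hi hi', (h4 i).2 hi hi'⟩,
        h5, h6, h7, h8⟩
  rw [e]
  have hc : ∀ i : Fin (M + 1), Continuous fun p : Fin (M + 1) → ℝ => p i := fun i => continuous_apply i
  refine IsOpen.inter (IsOpen.inter (IsOpen.inter (IsOpen.inter (IsOpen.inter (IsOpen.inter (IsOpen.inter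
    (isOpen_iInter_of_finite fun i => (isOpen_imp_lt _ continuous_const (hc i)).inter
      (isOpen_imp_lt _ (hc i) continuous_const))
    (isOpen_iInter_of_finite fun i => isOpen_iInter_of_finite fun i' => isOpen_imp_imp_lt _ _ (hc i') (hc i)))
    (isOpen_lt continuous_const (hc b)))
    (isOpen_iInter_of_finite fun i => (isOpen_imp_imp_lt _ _ continuous_const (hc i)).inter
      (isOpen_imp_imp_lt _ _ (hc i) continuous_const)))
    (isOpen_iInter_of_finite fun i => isOpen_iInter_of_finite fun i' => isOpen_imp3_lt _ _ _ (hc i) (hc i')))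
    (isOpen_iInter_of_finite fun i => isOpen_imp_lt _ continuous_const (hc i)))
    (isOpen_iInter_of_finite fun i => isOpen_iInter_of_finite fun i' => isOpen_imp_imp_lt _ _ (hc i') (hc i)))
    (isOpen_lt (continuous_lowR b) ((hc a).sub (hc b)))

/-! ### derivative and Jacobian of the run chart -/

/-- Auxiliary definition `rowSig`: row Sig. [bookkeeping] -/
def rowSig (a b : Fin (M + 1)) (p : Fin (M + 1) → ℝ) (i : Fin (M + 1)) : (Fin (M + 1) → ℝ) →L[ℝ] ℝ :=
  if a < i ∧ i < b then p b • PjM i + p i • PjM b else PjM i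

/-- Auxiliary definition `LSig`: LSig. [bookkeeping] -/
def LSig (a b : Fin (M + 1)) (p : Fin (M + 1) → ℝ) : (Fin (M + 1) → ℝ) →L[ℝ] (Fin (M + 1) → ℝ) :=
  ContinuousLinearMap.pi (rowSig a b p)

/-- Auxiliary definition `rowPsi`: row Psi. [bookkeeping] -/
def rowPsi (a b : Fin (M + 1)) (i : Fin (M + 1)) : (Fin (M + 1) → ℝ) →L[ℝ] ℝ :=
  if a < i ∧ i ≤ b then PjM a - PjM i else PjM i

/-- Auxiliary definition `LPsi`: LPsi. [bookkeeping] -/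
def LPsi (a b : Fin (M + 1)) : (Fin (M + 1) → ℝ) →L[ℝ] (Fin (M + 1) → ℝ) := ContinuousLinearMap.pi (rowPsi a b)

/-- Auxiliary step `hasFDerivAt_sigR`: has FDeriv At sig R. [bookkeeping] -/
theorem hasFDerivAt_sigR (a b : Fin (M + 1)) (p : Fin (M + 1) → ℝ) : HasFDerivAt (sigR a b) (LSig a b p) p := by
  refine hasFDerivAt_pi.2 fun i => ?_
  by_cases h : a < i ∧ i < b
  · have e : (fun q : Fin (M + 1) → ℝ => sigR a b q i) = fun q => q b * q i := funext fun q => by simp [sigR, h]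
    rw [e]; simp only [rowSig, if_pos h]
    exact (hasFDerivAt_apply (𝕜 := ℝ) b p).mul (hasFDerivAt_apply (𝕜 := ℝ) i p)
  · have e : (fun q : Fin (M + 1) → ℝ => sigR a b q i) = fun q => q i := funext fun q => by simp [sigR, h]
    rw [e]; simp only [rowSig, if_neg h]
    exact hasFDerivAt_apply (𝕜 := ℝ) i p

/-- Auxiliary step `psiR_eq_LPsi`: psi R eq LPsi. [bookkeeping] -/
theorem psiR_eq_LPsi (a b : Fin (M + 1)) (q : Fin (M + 1) → ℝ) : psiR a b q = LPsi a b q := by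
  funext i
  simp only [psiR, LPsi, ContinuousLinearMap.pi_apply, rowPsi]
  split_ifs <;> simp

/-- Auxiliary step `hasFDerivAt_psiR`: has FDeriv At psi R. [bookkeeping] -/
theorem hasFDerivAt_psiR (a b : Fin (M + 1)) (q : Fin (M + 1) → ℝ) : HasFDerivAt (psiR a b) (LPsi a b) q := by
  have e : psiR (M := M) a b = fun q => LPsi a b q := funext fun q => psiR_eq_LPsi a b q
  rw [e]; exact (LPsi a b).hasFDerivAt

/-- Auxiliary step `hasFDerivAt_mapR`: has FDeriv At map R. [bookkeeping] -/
theorem hasFDerivAt_mapR (a b : Fin (M + 1)) (p : Fin (M + 1) → ℝ) :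
    HasFDerivAt (mapR a b) ((LPsi a b).comp (LSig a b p)) p :=
  (hasFDerivAt_psiR a b (sigR a b p)).comp p (hasFDerivAt_sigR a b p)

/-- Auxiliary definition `MSig`: MSig. [bookkeeping] -/
def MSig (a b : Fin (M + 1)) (p : Fin (M + 1) → ℝ) : Matrix (Fin (M + 1)) (Fin (M + 1)) ℝ :=
  Matrix.of fun i l => if a < i ∧ i < b then (if l = i then p b else 0) + (if l = b then p i else 0)
    else (if l = i then 1 else 0)

/-- Auxiliary definition `MPsi`: MPsi. [bookkeeping] -/
def MPsi (a b : Fin (M + 1)) : Matrix (Fin (M + 1)) (Fin (M + 1)) ℝ :=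
  Matrix.of fun i l => if a < i ∧ i ≤ b then (if l = a then 1 else 0) - (if l = i then 1 else 0)
    else (if l = i then 1 else 0)

/-- Auxiliary step `LSig_eq_toLin'`: LSig eq to Lin'. [bookkeeping] -/
theorem LSig_eq_toLin' (a b : Fin (M + 1)) (p : Fin (M + 1) → ℝ) :
    (LSig a b p : (Fin (M + 1) → ℝ) →ₗ[ℝ] (Fin (M + 1) → ℝ)) = Matrix.toLin' (MSig a b p) := by
  apply LinearMap.ext
  intro h
  rw [Matrix.toLin'_apply, ContinuousLinearMap.coe_coe]
  funext i
  show rowSig a b p i h = _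
  simp only [rowSig, MSig, Matrix.mulVec, dotProduct, Matrix.of_apply]
  by_cases hi : a < i ∧ i < b
  · simp only [if_pos hi, add_mul, ite_mul, zero_mul, Finset.sum_add_distrib, Finset.sum_ite_eq', Finset.mem_univ,
      if_true]
    simp only [add_apply, FunLike.coe_smul, Pi.smul_apply, smul_eq_mul]
    rfl
  · simp only [if_neg hi, ite_mul, one_mul, zero_mul, Finset.sum_ite_eq', Finset.mem_univ, if_true]
    rfl

/-- Auxiliary step `LPsi_eq_toLin'`: LPsi eq to Lin'. [bookkeeping] -/
theorem LPsi_eq_toLin' (a b : Fin (M + 1)) :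
    (LPsi a b : (Fin (M + 1) → ℝ) →ₗ[ℝ] (Fin (M + 1) → ℝ)) = Matrix.toLin' (MPsi (M := M) a b) := by
  apply LinearMap.ext
  intro h
  rw [Matrix.toLin'_apply, ContinuousLinearMap.coe_coe]
  funext i
  show rowPsi a b i h = _
  simp only [rowPsi, MPsi, Matrix.mulVec, dotProduct, Matrix.of_apply]
  by_cases hi : a < i ∧ i ≤ b
  · simp only [if_pos hi, sub_mul, ite_mul, one_mul, zero_mul, Finset.sum_sub_distrib, Finset.sum_ite_eq',
      Finset.mem_univ, if_true]
    rfl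
  · simp only [if_neg hi, ite_mul, one_mul, zero_mul, Finset.sum_ite_eq', Finset.mem_univ, if_true]
    rfl

/-- number of interior run points `#{i | a < i < b}` (= `b − a − 1`) -/
def runInt (a b : Fin (M + 1)) : ℕ := (Finset.univ.filter fun i : Fin (M + 1) => a < i ∧ i < b).card

/-- Auxiliary step `runInt_eq`: run Int eq. [bookkeeping] -/
theorem runInt_eq (a b : Fin (M + 1)) : runInt a b = (b : ℕ) - a - 1 := by
  unfold runInt
  have e : (Finset.univ.filter fun i : Fin (M + 1) => a < i ∧ i < b) = Finset.Ioo a b := by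
    ext i; simp
  rw [e, Fin.card_Ioo]

/-- Auxiliary step `det_MSig`: det MSig. [bookkeeping] -/
theorem det_MSig (a b : Fin (M + 1)) (p : Fin (M + 1) → ℝ) : (MSig a b p).det = p b ^ runInt a b := by
  have htri : (MSig a b p).BlockTriangular id := by
    intro i l hlt
    have hlt' : l < i := hlt
    simp only [MSig, Matrix.of_apply]
    by_cases hi : a < i ∧ i < b
    · rw [if_pos hi, if_neg hlt'.ne, if_neg (fun h => by rw [h] at hlt'; exact absurd (hi.2.trans hlt') (lt_irrefl _)),
        add_zero]
    · rw [if_neg hi, if_neg hlt'.ne]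
  rw [Matrix.det_of_upperTriangular htri]
  have e : ∀ i, MSig a b p i i = if a < i ∧ i < b then p b else 1 := fun i => by
    simp only [MSig, Matrix.of_apply, if_true]
    by_cases hi : a < i ∧ i < b
    · rw [if_pos hi, if_pos hi, if_neg hi.2.ne, add_zero]
    · rw [if_neg hi, if_neg hi]
  simp only [e]
  rw [Finset.prod_ite, Finset.prod_const_one, mul_one, Finset.prod_const]
  rfl

end RunChart
end Summit.KontsevichZagierPeriods.KontsevichZagierPeriods.Cruxes.GZNormalFormWThree.GZLadder.RungFour
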